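import Mathlib
import HarnessLib
import Summits.HubbardSuperconductivity.HubbardSuperconductivity.Theorems.KLProgrammeKLRegimeSplitGeneric

/-!
# Route `KLProgramme` — RESTAGED generic children of crux K3 `KLRegimeTwoPointLimit` (stmt-HubbardSuperconductivity-19937):
# the renormalisation package `R` is chosen BEFORE the engine constants `Q` (defect Δ8, p2 g4 2026-08-26); glue re-proved.  Seat p2.

`KLProgrammeKLRegimeSplitGeneric.lean` states the four children `EngineP / BetaSplitP / CountertermP / TwoPointAssemblyP (Pr) (W)`
for any predicate bundle `Pr : Preds` with the constant staging `G → P → Q → R → c → U₀` and proves the glue once.  This module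
keeps `Preds`, `HistP`, `BetaSplitP`, `TwoPointAssemblyP` and every predicate BODY, and restates ONLY children 3 and 2 with `R`
before `Q` — `EngineP2 := ∃G ∀P ∀R ∃Q ∀c ∃U₀ …`, `CountertermP2 := ∀G ∀P ∃R ∀Q ∃c₁ ∀c ∃U₀ …` — together with
`RenConsts.WF2` (positive tolerances) and the glue `inductionP2` / `k3_inductionP2` / `k3_twoPointLimit_of_childrenP2` PROVED for
every bundle.  Nothing here asserts anything about the Hubbard model.  References: HOME/P2-C4B.md §9 (Δ8), HOME/DECOMP.md §8 (k).
-/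

noncomputable section

namespace Summit.HubbardSuperconductivity.HubbardSuperconductivity.Theorems.KLRegimeSplit

set_option linter.dupNamespace false -- summit = problem name (single-conjunct summit), D-0017

open Real Finset Filter Literature.MathematicalPhysics.QuantumLattice Literature.Probability.LatticeModels
open Literature.MathematicalPhysics.QuantumLattice.FermiRG
open Summit.HubbardSuperconductivity.HubbardSuperconductivity.Theorems.KLProgrammeLegKernels
open Summit.HubbardSuperconductivity.HubbardSuperconductivity.Theorems.DispersionFlow

/-! ## §1 Why `R` before `Q` (defect Δ8)

Why.  In `EngineP` the engine constants `Q` are chosen before the renormalisation package `R` (`∃ Q … ∀ R …`), so every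
engine output clause whose LEADING constant is a `Q`-constant must hold for frames of ANY size `R.Gfr` and ANY
renormalisation tolerance `R.cr`.  But the two-leg kernel of the scale-`n` action contains the frame vertex `K` at tree level
(`n = 0`: `FrameOK` allows `|K| ≤ (16/15)·R.Gfr 0·|U|`) and the renormalisation residue (`≤ 4·R.cr·|U|·Λ_n` at scale `n` from
`renorm (n-1)`), both LINEAR in `U` with `R`-dependent coefficients — no `U₀(R)` can absorb them into an `R`-free leading
constant (witness: the admissible CONSTANT frame `K = (R.Gfr 0/2)·U` at `n = 0`, where the history is vacuous).  Choosing `R`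
before `Q` removes the obstruction at no cost to child 2: the renormalisation package it needs (`cr`, `cz`, `Gfr j = G.S j + 1`)
depends on the absolute constants `G` only, every `Q`-dependence being one power of `U` down (Part 1's CONVENTION) and hence a
condition on child 2's own `U₀`, which IS chosen after `Q`.  The bodies of the per-scale predicates are untouched: only the
quantifier staging of children 3 and 2 changes (`EngineP2`, `CountertermP2`); children 1 and 4 (`BetaSplitP`,
`TwoPointAssemblyP`) are reused verbatim; the glue is re-proved in the order `G → P → R → Q → (c₀, c₁) → U₀`.  `R` now comes
with the positivity `RenConsts.WF2` (tolerances `cr, cz > 0`) that an engine OUTPUT stated against them needs. -/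

/-- **Well-formedness of `R`, v2**: signs (`RenConsts.WF`) AND strictly positive tolerances `0 < cr`, `0 < cz` (an engine output of
the form «mismatch `≤ cr·…`», «`|z - 1| ≤ cz·|U|`» is unprovable at tolerance `0`). -/
def RenConsts.WF2 (R : RenConsts) : Prop := R.WF ∧ 0 < R.cr ∧ 0 < R.cz

/-- `WF2` gives `WF`. -/
theorem RenConsts.WF2.wf {R : RenConsts} (h : R.WF2) : R.WF := h.1

/-- **Child 3, restaged: `EngineP2 Pr W`** (generic; route name `KLRegimeEngine` at a bundle and `W = klWindowC`; rank 2).  As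
`EngineP`, except that the engine constants `Q` are chosen AFTER the renormalisation package `R` (`∃ G ∀ P ∀ R ∃ Q ∀ c ∃ U₀ …`), so
that engine output clauses may carry `R`-dependent constants (Δ8), and `R` ranges over `RenConsts.WF2`. -/
def EngineP2 (Pr : Preds) (W : Set ℝ) : Prop :=
  ∃ G : GeoConsts, G.WF ∧ ∀ P : SplitConsts, P.WF → ∀ R : RenConsts, R.WF2 → ∃ Q : EngConsts, Q.WF ∧ ∀ c : ℝ, 0 < c →
    ∃ U₀ : ℝ, 0 < U₀ ∧ ∃ L₃ : ℝ → ℝ → ℕ, ∃ M₃ : ℝ → ℝ → ℕ → ℕ,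
      ∀ μ ∈ W, ∀ U : ℝ, 0 < U → U ≤ U₀ → ∀ β : ℝ, klBetaMin ≤ β → β ≤ Real.exp (c / U ^ 2) →
        ∀ K : TrigPolyC4v, Pr.frameOK R U (nScales β) μ K →
          ∀ (L M : ℕ) [NeZero L] [NeZero M], L₃ β U ≤ L → M₃ β U L ≤ M →
            ∀ n : ℕ, n ≤ nScales β → IsKLRegime U c (-(n : ℤ)) → HistP Pr L M G P Q R β U μ K n →
              Pr.engine L M G P Q β U μ K n ∧ Pr.twoLeg L M G P Q R β U μ K n

/-- **Child 2, restaged: `CountertermP2 Pr W`** (generic; route name `KLRegimeCounterterm`; rank 4), VOLUME-UNIFORM.  As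
`CountertermP`, except that the renormalisation package `R` (with `RenConsts.WF2`) is chosen knowing `G` and `P` only, BEFORE the
engine constants `Q` (`∀ G ∀ P ∃ R ∀ Q ∃ c₁ ∀ c ∃ U₀ …`) — child 2 can: its tolerances and frame allowances are functions of the
absolute constants, and whatever depends on `Q` is one power of `U` down and is paid by its `U₀` (Δ8). -/
def CountertermP2 (Pr : Preds) (W : Set ℝ) : Prop :=
  ∀ G : GeoConsts, ∀ P : SplitConsts, G.WF → P.WF → ∃ R : RenConsts, R.WF2 ∧ ∀ Q : EngConsts, Q.WF →
    ∃ c₁ : ℝ, 0 < c₁ ∧ ∀ c : ℝ, 0 < c → c ≤ c₁ → ∃ U₀ : ℝ, 0 < U₀ ∧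
      ∀ μ ∈ W, ∀ U : ℝ, 0 < U → U ≤ U₀ → ∀ β : ℝ, klBetaMin ≤ β → β ≤ Real.exp (c / U ^ 2) →
        ∀ (Lh : ℕ) (Mh : ℕ → ℕ),
          (∀ K : TrigPolyC4v, Pr.frameOK R U (nScales β) μ K →
            ∀ (L M : ℕ) [NeZero L] [NeZero M], Lh ≤ L → Mh L ≤ M →
              ∀ n : ℕ, n ≤ nScales β → (∀ j < n, Pr.renorm L M β U μ K R j) →
                Pr.engine L M G P Q β U μ K n ∧ Pr.twoLeg L M G P Q R β U μ K n ∧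
                  Pr.split L M G P Q β U μ K n) →
          ∃ K : TrigPolyC4v, Pr.frameOK R U (nScales β) μ K ∧ ∃ (Lc : ℕ) (Mc : ℕ → ℕ),
            ∀ (L M : ℕ) [NeZero L] [NeZero M], Lc ≤ L → Mc L ≤ M →
              ∀ n : ℕ, n ≤ nScales β → Pr.renorm L M β U μ K R n

/-- **GLUE for the restaged children** (covariance window `W` receiving `μ - U/2`): `EngineP2`, `BetaSplitP`, `CountertermP2`,
`TwoPointAssemblyP` on `W` give K3 on the analysis window.  Order of choices: `G` (child 3) → `P` (child 1) → `R` (child 2, from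
`G, P`) → `Q` (child 3, from `P, R`) → `c₀` (child 1), `c₁` (child 2) → `c = min c₀ c₁` → the four `U₀`'s, `a / log 128`, `1/10`;
then per `(μ, U, β)` exactly as `inductionP`. -/
theorem inductionP2 {Pr : Preds} {W : Set ℝ}
    (hW : ∀ μ ∈ Set.Icc (-1 : ℝ) (-0.15), ∀ U : ℝ, 0 < U → U ≤ 1 / 10 → μ - U / 2 ∈ W)
    (h₃ : EngineP2 Pr W) (h₁ : BetaSplitP Pr W) (h₂ : CountertermP2 Pr W) (h₄ : TwoPointAssemblyP Pr W) :
    KLRegimeTwoPointLimitMu (-1) (-0.15) := by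
  intro a ha
  obtain ⟨G, hG, h₃P⟩ := h₃
  obtain ⟨P, hP, h₁Q⟩ := h₁ G hG
  obtain ⟨R, hR2, h₂Q⟩ := h₂ G P hG hP
  have hR : R.WF := hR2.wf
  obtain ⟨Q, hQ, h₃c⟩ := h₃P P hP R hR2
  obtain ⟨c₀, hc₀, h₁c⟩ := h₁Q Q hQ
  obtain ⟨c₁, hc₁, h₂c⟩ := h₂Q Q hQ
  set c : ℝ := min c₀ c₁ with hc_def
  have hc : 0 < c := lt_min hc₀ hc₁
  obtain ⟨U₃, hU₃, L₃, M₃, h₃main⟩ := h₃c c hc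
  obtain ⟨U₁, hU₁, L₁, M₁, h₁main⟩ := h₁c c hc (min_le_left _ _) R hR
  obtain ⟨U₂, hU₂, h₂main⟩ := h₂c c hc (min_le_right _ _)
  obtain ⟨U₄, hU₄, h₄main⟩ := h₄ G P Q R hG hP hQ hR c hc
  have hlog : 0 < Real.log klBetaMin := Real.log_pos (by norm_num [klBetaMin])
  set U₀ : ℝ := min (min (min (min U₁ U₂) (min U₃ U₄)) (a / Real.log klBetaMin)) (1 / 10) with hU₀_def
  have hU₀ : 0 < U₀ :=
    lt_min (lt_min (lt_min (lt_min hU₁ hU₂) (lt_min hU₃ hU₄)) (div_pos ha hlog)) (by norm_num)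
  refine ⟨U₀, c, hU₀, hc, ?_⟩
  intro μ hμ U β hU hUle hβa hβc x y σ σ'
  have hU5 : U ≤ min (min (min U₁ U₂) (min U₃ U₄)) (a / Real.log klBetaMin) := hUle.trans (min_le_left _ _)
  have hU10 : U ≤ 1 / 10 := hUle.trans (min_le_right _ _)
  have hU1 : U ≤ U₁ := hU5.trans ((min_le_left _ _).trans ((min_le_left _ _).trans (min_le_left _ _)))
  have hU2 : U ≤ U₂ := hU5.trans ((min_le_left _ _).trans ((min_le_left _ _).trans (min_le_right _ _)))
  have hU3 : U ≤ U₃ := hU5.trans ((min_le_left _ _).trans ((min_le_right _ _).trans (min_le_left _ _)))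
  have hU4 : U ≤ U₄ := hU5.trans ((min_le_left _ _).trans ((min_le_right _ _).trans (min_le_right _ _)))
  have hβmin : klBetaMin ≤ β := klBetaMin_le_of_exp_le hU hU5 (min_le_right _ _) hβa
  have hβpos : 0 < β := pos_of_klBetaMin_le hβmin
  have hKL : ∀ n ≤ nScales β, IsKLRegime U c (-(n : ℤ)) := fun n hn =>
    isKLRegime_of_le_tempScaleIdx hc.le hβpos hβc hn
  -- the covariance potential
  set ν : ℝ := μ - U / 2 with hν_def
  have hν : ν ∈ W := hW μ hμ U hU hU10
  -- the glued induction (children 3 + 1) for EVERY admissible frame, beyond the maxed hypothesis thresholds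
  have hall : ∀ K : TrigPolyC4v, Pr.frameOK R U (nScales β) ν K →
      ∀ (L M : ℕ) [NeZero L] [NeZero M], max (L₃ β U) (L₁ β U) ≤ L → max (M₃ β U L) (M₁ β U L) ≤ M →
        ∀ n : ℕ, n ≤ nScales β → (∀ j < n, Pr.renorm L M β U ν K R j) →
          Pr.engine L M G P Q β U ν K n ∧ Pr.twoLeg L M G P Q R β U ν K n ∧
            Pr.split L M G P Q β U ν K n := by
    intro K hK L M _ _ hL hM n hn hRn
    have hL3 : L₃ β U ≤ L := (le_max_left _ _).trans hL
    have hL1 : L₁ β U ≤ L := (le_max_right _ _).trans hL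
    have hM3 : M₃ β U L ≤ M := (le_max_left _ _).trans hM
    have hM1 : M₁ β U L ≤ M := (le_max_right _ _).trans hM
    exact Child.allScales (N := nScales β) (KL := fun n => IsKLRegime U c (-(n : ℤ)))
      (B := fun n => Pr.split L M G P Q β U ν K n) (Rn := fun n => Pr.renorm L M β U ν K R n)
      (E := fun n => Pr.engine L M G P Q β U ν K n) (T := fun n => Pr.twoLeg L M G P Q R β U ν K n)
      (fun n hn hkl hyp => h₃main ν hν U hU hU3 β hβmin hβc K hK L M hL3 hM3 n hn hkl hyp)
      (fun n hn hkl hyp hEn hTn => h₁main ν hν U hU hU1 β hβmin hβc K hK L M hL1 hM1 n hn hkl hyp hEn hTn)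
      hKL n hn hRn
  -- child 2: the volume-uniform renormalised admissible frame and its thresholds
  obtain ⟨K, hK, Lc, Mc, hKR⟩ :=
    h₂main ν hν U hU hU2 β hβmin hβc (max (L₃ β U) (L₁ β U)) (fun L => max (M₃ β U L) (M₁ β U L)) hall
  -- child 4 at the covariance potential, beyond every threshold; its conclusion is at ν + U/2 = μ
  have hphys : ν + U / 2 = μ := by rw [hν_def]; ring
  have h4 := h₄main ν hν U hU hU4 β hβmin hβc (max Lc (max (L₃ β U) (L₁ β U)))
    (fun L => max (Mc L) (max (M₃ β U L) (M₁ β U L))) ⟨K, hK, ?_⟩ x y σ σ'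
  · rwa [hphys] at h4
  intro L M _ _ hL hM n hn
  have hLc : Lc ≤ L := (le_max_left _ _).trans hL
  have hLh : max (L₃ β U) (L₁ β U) ≤ L := (le_max_right _ _).trans hL
  have hMc : Mc L ≤ M := (le_max_left _ _).trans hM
  have hMh : max (M₃ β U L) (M₁ β U L) ≤ M := (le_max_right _ _).trans hM
  have h := hall K hK L M hLh hMh n hn fun j hj => hKR L M hLc hMc j (le_of_lt (lt_of_lt_of_le hj hn))
  exact ⟨hKR L M hLc hMc n hn, h.2.2, h.1, h.2.1⟩

/-- **GLUE for the restaged children on the covariance window `klWindowC`**: K3 on the analysis window. -/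
theorem k3_inductionP2 {Pr : Preds} (h₃ : EngineP2 Pr klWindowC) (h₁ : BetaSplitP Pr klWindowC)
    (h₂ : CountertermP2 Pr klWindowC) (h₄ : TwoPointAssemblyP Pr klWindowC) : KLRegimeTwoPointLimitMu (-1) (-0.15) :=
  inductionP2 (fun _ hμ _ hU hU' => sub_half_mem_klWindowC hμ hU hU') h₃ h₁ h₂ h₄

/-- **The crux modulo S0, from the restaged children** (as `k3_twoPointLimit_of_childrenP`). -/
theorem k3_twoPointLimit_of_childrenP2 {Pr : Preds} (h₃ : EngineP2 Pr klWindowC) (h₁ : BetaSplitP Pr klWindowC)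
    (h₂ : CountertermP2 Pr klWindowC) (h₄ : TwoPointAssemblyP Pr klWindowC)
    (hS0 : ∀ δ ∈ Set.Icc (0.10 : ℝ) 0.35,
      chemicalPotentialOfDensity (squareDispersion 1 0) (1 - δ) ∈ Set.Icc (-1 : ℝ) (-0.15)) :
    ∀ a : ℝ, 0 < a → ∃ U₀ c : ℝ, 0 < U₀ ∧ 0 < c ∧ ∀ δ ∈ Set.Icc (0.10 : ℝ) 0.35, ∀ U β : ℝ, 0 < U → U ≤ U₀ →
      Real.exp (a / U) ≤ β → β ≤ Real.exp (c / U ^ 2) → ∀ (x y : Site 2) (σ σ' : Fin 2), ∃ S : ℂ,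
        Tendsto (fun L : ℕ => hubbardThermalTwoPoint β U
          (chemicalPotentialOfDensity (squareDispersion 1 0) (1 - δ)) L x y σ σ') atTop (nhds S) := by
  intro a ha
  obtain ⟨U₀, c, hU₀, hc, H⟩ := k3_inductionP2 h₃ h₁ h₂ h₄ a ha
  exact ⟨U₀, c, hU₀, hc, fun δ hδ U β hU hUle hβ hβ' x y σ σ' => H _ (hS0 δ hδ) U β hU hUle hβ hβ' x y σ σ'⟩

/-- The restaged engine child is implied by the original one (a `Q` chosen before `R` serves every `R`): nothing proved on
`EngineP` is lost. -/
theorem engineP2_of_engineP {Pr : Preds} {W : Set ℝ} (h : EngineP Pr W) : EngineP2 Pr W := by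
  obtain ⟨G, hG, hGP⟩ := h
  refine ⟨G, hG, fun P hP R hR => ?_⟩
  obtain ⟨Q, hQ, hR'⟩ := hGP P hP
  exact ⟨Q, hQ, hR' R hR.wf⟩

end Summit.HubbardSuperconductivity.HubbardSuperconductivity.Theorems.KLRegimeSplit

end
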